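import Literature.NumberTheory.GaloisCohomology.PoitouTateRestrictedShaTwoOfLocalInjectivity
import Literature.NumberTheory.GaloisCohomology.PoitouTateRestrictedShaNaturalAtOfIdeleClassFormation
import Literature.NumberTheory.GaloisRepresentations.IdeleClassBarSTateDualityHypotheses
import HarnessLib

/-!
# `poitouTate_shaRestricted_tateDual_natural_at K ↑S'` (`K` totally complex) from THREE displayed inputs:
# [P2-mono], the layer bridge `nat`, and the `S`-readouts `R` with (R3)/(R4) for the CANONICAL local invariant maps

Topic `NumberTheory/GaloisCohomology`; namespace `Literature.NumberTheory.GaloisCohomology.ShaExtRoadKit`.  Theorems only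
(no definition, no named fact, no instance, no notation, no `sorry`).  Lane «PT-Ш-S-TC» of cell `bsd-eis` (crux
`GoodLatticeBDPValue`, `stmt-BirchSwinnertonDyer-19032`), KIT GLUE (seat bsd-line-x1-p1-w2 gen 12): the lane's closer recipe
`ShaExtRoadKit.natural_at_of_idele_class_formation'` (-w2 g11) with every slot the tree can already fill FILLED —

* `Sig := Ω_∞ ⊔ S'` (`Finset.univ.disjSum S'`, no decidability instance involved; `hSig₁`, `hSig₂` proved);
* `linv n := LocalInvariants.canonical K n` with `hperf := LocalInvariants.canonical_isPerfect` (local Tate duality at the finite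
  places, PROVED in the tree) — the family for which the tree's all-places reciprocity law (R4) is stated;
* `hα` := Tate duality `α¹(G_S, C̄_S)` for `⟨(M^D(n))^{N_S}⟩` — bsd-eis -w8 g13's `IdeleClassBar.adjointMap_one_bijective_classBarSD`
  (D2 ASSEMBLY) at the support bookkeeping `forall_natCard_obj_mem_of_natCard_mem` (`hα_classBarSD` below);
* `hΨsha` := `ShaExtRoadKit.hΨsha` (UNCONDITIONAL) and `hΨsurj` := `ShaExtRoadKit.hΨsurj_of_P2mono` (FILE Ψ);

leaving DISPLAYED exactly: [P2-mono] (Milne I Lemma 4.13 at `r = 2`, raw Shapiro form; bsd-eis -w3, -w8, LEAD, -w4), the degree-1 layer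
bridge `nat` with `hnat`/`hnatG` (-w5 `natLayerS`), and the `S`-readouts `R` with (R3) `hR3` and (R4) `hR4` in the kit's
shape at `linv := canonical`, `Sig := Ω_∞ ⊔ S'` (D4b/F2d: bsd-eis -w6, -w5).

HONEST FRAMING: plumbing; none of the three displayed inputs is proved here; no case of Poitou–Tate duality and nothing about
BSD is proved here.  AI formalisation, established only by the kernel check.

## References
* J. S. Milne, *Arithmetic Duality Theorems*, 2nd ed. (2006), I Thm. 4.10 (a) (p. 57), its proof (p. 58), §4 p. 65,
  I Cor. 2.3. [MilneADT2006]
* D. Harari, *Galois Cohomology and Class Field Theory*, Universitext (2020), §17.4 (17.1), Thm. 17.13 (b), Thm. 17.18,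
  §17.5. [Harari2020]
-/

noncomputable section

open CategoryTheory CategoryTheory.Abelian NumberField IsDedekindDomain Function Field
open scoped NumberField ContRepresentation

namespace Literature.NumberTheory.GaloisCohomology

namespace ShaExtRoadKit

open Literature.Algebra.Homology Literature.Algebra.Homology.DiscreteRep Literature.Algebra.Homology.ExtDuality
open Literature.NumberTheory.GaloisRepresentations
open Literature.NumberTheory.GaloisRepresentations.DiscreteGaloisModule
open Literature.AnabelianGeometry.AbsoluteAnabelian.Prop121vii (zmodToQmodZ)

variable (K : Type) [Field K] [NumberField K] (S : Finset (HeightOneSpectrum (𝓞 K)))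

/-! ## §1 `Σ = Ω_∞ ⊔ S'` -/

/-- Every infinite place lies in `Ω_∞ ⊔ S'`. [cite: MilneADT2006, I Thm. 4.10 (a) (p. 57)] -/
theorem inl_mem_sigma (w : InfinitePlace K) :
    (Sum.inl w : Place K) ∈ (Finset.univ : Finset (InfinitePlace K)).disjSum S :=
  Finset.inl_mem_disjSum.2 (Finset.mem_univ w)

omit [NumberField K] in
/-- A finite place lies in `Ω_∞ ⊔ S'` iff it lies in `S'`. [cite: MilneADT2006, I Thm. 4.10 (a) (p. 57)] -/
theorem inr_mem_sigma_iff [Fintype (InfinitePlace K)] (v : HeightOneSpectrum (𝓞 K)) :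
    (Sum.inr v : Place K) ∈ (Finset.univ : Finset (InfinitePlace K)).disjSum S ↔
      v ∈ (↑S : Set (HeightOneSpectrum (𝓞 K))) := by
  rw [Finset.mem_coe, Finset.inr_mem_disjSum]

/-! ## §2 `hα`: Tate duality `α¹(G_S, C̄_S)` at `⟨(M^D(n))^{N_S}⟩` (bsd-eis -w8 g13's D2 ASSEMBLY) -/

set_option maxRecDepth 16384 in
/-- **`hα` OF THE CLOSER'S KIT, VERBATIM**: for every admissible `(n, M, ρ)`, `α¹(G_S, ⟨(M^D(n))^{N_S}⟩)` is bijective for the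
invariant map `inv_S` of the `S`-idèle class formation — -w8 g13's `IdeleClassBar.adjointMap_one_bijective_classBarSD` (Tate–Nakayama
for `(G_S, C̄_S)` prime by prime) at the support bookkeeping `#⟨(M^D(n))^{N_S}⟩ ∣ #M`.
[cite: Harari2020, Thm. 17.18][cite: MilneADT2006, I Thm. 4.10 (a) (p. 57: "S contains all primes dividing the order of M")] -/
theorem hα_classBarSD :
    ∀ (n : ℕ) [NeZero n] (M : Type) [AddCommGroup M] [TopologicalSpace M] [DiscreteTopology M]
      [Finite M] (ρ : DiscreteGaloisModule K M), (∀ m : M, n • m = 0) →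
      GaloisRep.IsUnramifiedOutside (↑S : Set (HeightOneSpectrum (𝓞 K))) ρ →
      (∀ v : HeightOneSpectrum (𝓞 K), ((Nat.card M : ℕ) : 𝓞 K) ∈ v.asIdeal → v ∈ (↑S : Set (HeightOneSpectrum (𝓞 K)))) →
      Bijective (ExtDuality.adjointMap (P := triv (Γ := GaloisGroupUnramifiedOutside K (↑S : Set (HeightOneSpectrum (𝓞 K)))) ℤ)
        (IdeleClassBar.invS S) (ofContinuousRep ((ρ.tateDual n).quotientInvariants
        (ramificationSubgroup K (↑S : Set (HeightOneSpectrum (𝓞 K)))))) (rfl : 1 + 1 = 2)) :=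
  fun n _ M _ _ _ _ ρ hn _ hS =>
    haveI : Finite (TateDual K M n) := TateDual.finite K M n
    haveI := finite_obj_ofContinuousRep_quotientInvariants_tateDual K S (n := n) (ρ := ρ)
    IdeleClassBar.adjointMap_one_bijective_classBarSD S _
      (fun v hv => forall_natCard_obj_mem_of_natCard_mem (↑S : Set (HeightOneSpectrum (𝓞 K))) ρ n hn hS v hv)

/-! ## §3 The closer behind [P2-mono], `nat`, and the canonical `S`-readouts -/

set_option maxRecDepth 16384 in
-- (as for `natural_at_of_kit`: the composed objects exceed the default recursion depth)
/-- **`poitouTate_shaRestricted_tateDual_natural_at K ↑S'` for `K` totally complex from [P2-mono], the layer bridge `nat`, and the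
canonical `S`-readouts `R` with (R3)/(R4)** — `natural_at_of_idele_class_formation'` with `Sig := Ω_∞ ⊔ S'` (`Finset.univ.disjSum S'`),
`linv := LocalInvariants.canonical`, `hperf := canonical_isPerfect`, `hα := hα_classBarSD`, `hΨsha := hΨsha`,
`hΨsurj := hΨsurj_of_P2mono hP2`. [cite: MilneADT2006, I Thm. 4.10 (a) (p. 57), its proof (p. 58) and §4 p. 65]
[cite: Harari2020, §17.4 (17.1), Thm. 17.13 (b), Thm. 17.18, §17.5] -/
theorem natural_at_of_P2mono [IsTotallyComplex K]
    (hP2 : ∀ (U : Subgroup (GaloisGroupUnramifiedOutside K (↑S : Set (HeightOneSpectrum (𝓞 K))))) [U.Normal]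
      (_ : IsOpen (U : Set (GaloisGroupUnramifiedOutside K (↑S : Set (HeightOneSpectrum (𝓞 K)))))) [U.FiniteIndex],
      ∀ y : Ext (triv (k := ℤ) (Γ := ↥U) ℤ) ((resD ℤ U).obj (IdeleClassBar.truncIdeleBarD K S)) 2,
        (∀ (w : IdeleReadout.OverS K S) (t : DoubleCosets (IdeleReadout.decompMapPlaceS K S w.1) U),
          (y.mapExactFunctor (resDHom ℤ (conjHom (IdeleReadout.decompMapPlaceS K S w.1) U
              (dcRep (IdeleReadout.decompMapPlaceS K S w.1) U t))
            (continuous_conjHom (IdeleReadout.decompMapPlaceS K S w.1) (IdeleReadout.continuous_decompMapPlaceS K S w.1) U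
              (dcRep (IdeleReadout.decompMapPlaceS K S w.1) U t)))).comp
            (Ext.mk₀ (conjCoeff (IdeleReadout.decompMapPlaceS K S w.1) (IdeleReadout.continuous_decompMapPlaceS K S w.1) U
              (IdeleClassBar.truncIdeleBarD K S) (IdeleReadout.unitsD (Place.Completion w.1)) (IdeleReadout.locQ K S w)
              (dcRep (IdeleReadout.decompMapPlaceS K S w.1) U t) (k := ℤ))) (add_zero 2) = 0) → y = 0)
    (nat : ∀ (n : ℕ) (M : Type) [AddCommGroup M] [TopologicalSpace M] [DiscreteTopology M] [Finite M]
      (ρ : DiscreteGaloisModule K M), restrictedCohomology (ρ.tateDual n) (↑S : Set (HeightOneSpectrum (𝓞 K))) 1 →+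
        Ext (triv (Γ := GaloisGroupUnramifiedOutside K (↑S : Set (HeightOneSpectrum (𝓞 K)))) ℤ) (ofContinuousRep ((ρ.tateDual n).quotientInvariants
        (ramificationSubgroup K (↑S : Set (HeightOneSpectrum (𝓞 K)))))) 1)
    (hnat : ∀ (n : ℕ) (M : Type) [AddCommGroup M] [TopologicalSpace M] [DiscreteTopology M] [Finite M]
      (ρ : DiscreteGaloisModule K M), Bijective (nat n M ρ))
    (hnatG : ∀ (n n' : ℕ) (M M' : Type) [AddCommGroup M] [TopologicalSpace M] [DiscreteTopology M] [Finite M]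
      [AddCommGroup M'] [TopologicalSpace M'] [DiscreteTopology M'] [Finite M']
      (ρ : DiscreteGaloisModule K M) (ρ' : DiscreteGaloisModule K M')
      (G : (ρ'.tateDual n').toTopRep ⟶ (ρ.tateDual n).toTopRep) (c : restrictedCohomology (ρ'.tateDual n') (↑S : Set (HeightOneSpectrum (𝓞 K))) 1),
      nat n M ρ ((ContinuousCohomology.map (ContinuousMonoidHom.id (GaloisGroupUnramifiedOutside K (↑S : Set (HeightOneSpectrum (𝓞 K)))))
        (ContinuousRep.invariantsHom (N := ramificationSubgroup K (↑S : Set (HeightOneSpectrum (𝓞 K)))) G) 1).hom c) =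
        (nat n' M' ρ' c).comp
          (Ext.mk₀ (RestrictedExtTriv.quotientInvariantsMap (ρ'.tateDual n') (ρ.tateDual n) (↑S : Set (HeightOneSpectrum (𝓞 K))) G)) (add_zero 1))
    (R : ∀ (n : ℕ) (M : Type) [AddCommGroup M] [TopologicalSpace M] [DiscreteTopology M] [Finite M]
      (ρ : DiscreteGaloisModule K M) (v : Place K),
      Ext (ofContinuousRep ((ρ.tateDual n).quotientInvariants
        (ramificationSubgroup K (↑S : Set (HeightOneSpectrum (𝓞 K)))))) (IdeleClassBar.truncIdeleBarD K S) 1 →+ galoisCohomology (ρ.toLocal v) 1)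
    (hR3 : ∀ (n : ℕ) [NeZero n] (M : Type) [AddCommGroup M] [TopologicalSpace M] [DiscreteTopology M]
      [Finite M] (ρ : DiscreteGaloisModule K M), (∀ m : M, n • m = 0) →
      GaloisRep.IsUnramifiedOutside (↑S : Set (HeightOneSpectrum (𝓞 K))) ρ →
      (∀ v : HeightOneSpectrum (𝓞 K), ((Nat.card M : ℕ) : 𝓞 K) ∈ v.asIdeal → v ∈ (↑S : Set (HeightOneSpectrum (𝓞 K)))) →
      ∀ t : Π v : Place K, galoisCohomology (ρ.toLocal v) 1,
        ∃ e : Ext (ofContinuousRep ((ρ.tateDual n).quotientInvariants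
        (ramificationSubgroup K (↑S : Set (HeightOneSpectrum (𝓞 K)))))) (IdeleClassBar.truncIdeleBarD K S) 1,
          ∀ v ∈ (Finset.univ : Finset (InfinitePlace K)).disjSum S, R n M ρ v e = t v)
    (hR4 : ∀ (n : ℕ) [NeZero n] (M : Type) [AddCommGroup M] [TopologicalSpace M] [DiscreteTopology M]
      [Finite M] (ρ : DiscreteGaloisModule K M), (∀ m : M, n • m = 0) →
      GaloisRep.IsUnramifiedOutside (↑S : Set (HeightOneSpectrum (𝓞 K))) ρ →
      (∀ v : HeightOneSpectrum (𝓞 K), ((Nat.card M : ℕ) : 𝓞 K) ∈ v.asIdeal → v ∈ (↑S : Set (HeightOneSpectrum (𝓞 K)))) →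
      ∀ (e : Ext (ofContinuousRep ((ρ.tateDual n).quotientInvariants
        (ramificationSubgroup K (↑S : Set (HeightOneSpectrum (𝓞 K)))))) (IdeleClassBar.truncIdeleBarD K S) 1)
        (y : restrictedCohomology (ρ.tateDual n) (↑S : Set (HeightOneSpectrum (𝓞 K))) 1),
        ShaExtRoad.read ρ (↑S : Set (HeightOneSpectrum (𝓞 K))) (T := IdeleClassBar.truncSeqS K S) (ofContinuousRep ((ρ.tateDual n).quotientInvariants
        (ramificationSubgroup K (↑S : Set (HeightOneSpectrum (𝓞 K)))))) (triv ℤ) (IdeleClassBar.invS S)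
            (nat n M ρ) (ShaExtRoad.idelePart (T := IdeleClassBar.truncSeqS K S) (ofContinuousRep ((ρ.tateDual n).quotientInvariants
        (ramificationSubgroup K (↑S : Set (HeightOneSpectrum (𝓞 K)))))) e) y =
          zmodToQmodZ n (∑ v ∈ (Finset.univ : Finset (InfinitePlace K)).disjSum S,
            localTatePairingZMod ρ n v (LocalInvariants.canonical K n v) (R n M ρ v e)
            (restrictedLocalization (ρ.tateDual n) (↑S : Set (HeightOneSpectrum (𝓞 K))) v 1 y))) :
    poitouTate_shaRestricted_tateDual_natural_at K (↑S : Set (HeightOneSpectrum (𝓞 K))) := by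
  -- the kit wants a family at EVERY level `n : ℕ`; take the canonical one at `n ≥ 1` and `0` at `n = 0`
  let linv : ∀ n : ℕ, LocalInvariants K n := fun n =>
    if h : n = 0 then 0 else (haveI : NeZero n := ⟨h⟩; LocalInvariants.canonical K n)
  have hlinv : ∀ (n : ℕ) [NeZero n], linv n = LocalInvariants.canonical K n := fun n _ => dif_neg (NeZero.ne n)
  refine natural_at_of_idele_class_formation' S ((Finset.univ : Finset (InfinitePlace K)).disjSum S)
    (inl_mem_sigma K S) (inr_mem_sigma_iff K S) linv (fun n _ => ?_) R nat hnat hnatG (hα_classBarSD K S) hR3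
    (fun n _ M _ _ _ _ ρ hn hur hS e y => ?_) (hΨsha K S) (hΨsurj_of_P2mono K S hP2)
  · rw [hlinv]
    exact LocalInvariants.canonical_isPerfect
  · rw [hlinv]
    exact hR4 n M ρ hn hur hS e y

/-! ## §4 The same with the `S`-readouts given on ADMISSIBLE triples only -/

set_option maxRecDepth 16384 in
-- (as for `natural_at_of_kit`: the composed objects exceed the default recursion depth)
/-- **`natural_at_of_P2mono` with the readouts `R` supplied only on admissible `(n, M, ρ)`** (`n ≥ 1`, `n • M = 0`, `M`
unramified outside `S'`, every `v ∣ #M` in `S'` — the hypotheses under which the `S`-readout `readoutSExt` and its biduality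
transport exist): the kit's TOTAL readout slot is filled by `R` on admissible triples and `0` elsewhere (`dite`), and (R3)/(R4)
are transported along `dif_pos`.  This is the binder the lane's F2d ASSEMBLY (bsd-eis -w5) produces.
[cite: MilneADT2006, I Thm. 4.10 (a) (p. 57), its proof (p. 58) and §4 p. 65][cite: Harari2020, §17.4 (17.1), Thm. 17.13 (b), §17.5] -/
theorem natural_at_of_P2mono' [IsTotallyComplex K]
    (hP2 : ∀ (U : Subgroup (GaloisGroupUnramifiedOutside K (↑S : Set (HeightOneSpectrum (𝓞 K))))) [U.Normal]
      (_ : IsOpen (U : Set (GaloisGroupUnramifiedOutside K (↑S : Set (HeightOneSpectrum (𝓞 K)))))) [U.FiniteIndex],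
      ∀ y : Ext (triv (k := ℤ) (Γ := ↥U) ℤ) ((resD ℤ U).obj (IdeleClassBar.truncIdeleBarD K S)) 2,
        (∀ (w : IdeleReadout.OverS K S) (t : DoubleCosets (IdeleReadout.decompMapPlaceS K S w.1) U),
          (y.mapExactFunctor (resDHom ℤ (conjHom (IdeleReadout.decompMapPlaceS K S w.1) U
              (dcRep (IdeleReadout.decompMapPlaceS K S w.1) U t))
            (continuous_conjHom (IdeleReadout.decompMapPlaceS K S w.1) (IdeleReadout.continuous_decompMapPlaceS K S w.1) U
              (dcRep (IdeleReadout.decompMapPlaceS K S w.1) U t)))).comp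
            (Ext.mk₀ (conjCoeff (IdeleReadout.decompMapPlaceS K S w.1) (IdeleReadout.continuous_decompMapPlaceS K S w.1) U
              (IdeleClassBar.truncIdeleBarD K S) (IdeleReadout.unitsD (Place.Completion w.1)) (IdeleReadout.locQ K S w)
              (dcRep (IdeleReadout.decompMapPlaceS K S w.1) U t) (k := ℤ))) (add_zero 2) = 0) → y = 0)
    (nat : ∀ (n : ℕ) (M : Type) [AddCommGroup M] [TopologicalSpace M] [DiscreteTopology M] [Finite M]
      (ρ : DiscreteGaloisModule K M), restrictedCohomology (ρ.tateDual n) (↑S : Set (HeightOneSpectrum (𝓞 K))) 1 →+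
        Ext (triv (Γ := GaloisGroupUnramifiedOutside K (↑S : Set (HeightOneSpectrum (𝓞 K)))) ℤ) (ofContinuousRep ((ρ.tateDual n).quotientInvariants
        (ramificationSubgroup K (↑S : Set (HeightOneSpectrum (𝓞 K)))))) 1)
    (hnat : ∀ (n : ℕ) (M : Type) [AddCommGroup M] [TopologicalSpace M] [DiscreteTopology M] [Finite M]
      (ρ : DiscreteGaloisModule K M), Bijective (nat n M ρ))
    (hnatG : ∀ (n n' : ℕ) (M M' : Type) [AddCommGroup M] [TopologicalSpace M] [DiscreteTopology M] [Finite M]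
      [AddCommGroup M'] [TopologicalSpace M'] [DiscreteTopology M'] [Finite M']
      (ρ : DiscreteGaloisModule K M) (ρ' : DiscreteGaloisModule K M')
      (G : (ρ'.tateDual n').toTopRep ⟶ (ρ.tateDual n).toTopRep) (c : restrictedCohomology (ρ'.tateDual n') (↑S : Set (HeightOneSpectrum (𝓞 K))) 1),
      nat n M ρ ((ContinuousCohomology.map (ContinuousMonoidHom.id (GaloisGroupUnramifiedOutside K (↑S : Set (HeightOneSpectrum (𝓞 K)))))
        (ContinuousRep.invariantsHom (N := ramificationSubgroup K (↑S : Set (HeightOneSpectrum (𝓞 K)))) G) 1).hom c) =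
        (nat n' M' ρ' c).comp
          (Ext.mk₀ (RestrictedExtTriv.quotientInvariantsMap (ρ'.tateDual n') (ρ.tateDual n) (↑S : Set (HeightOneSpectrum (𝓞 K))) G)) (add_zero 1))
    (R : ∀ (n : ℕ) [NeZero n] (M : Type) [AddCommGroup M] [TopologicalSpace M] [DiscreteTopology M] [Finite M]
      (ρ : DiscreteGaloisModule K M), (∀ m : M, n • m = 0) →
      GaloisRep.IsUnramifiedOutside (↑S : Set (HeightOneSpectrum (𝓞 K))) ρ →
      (∀ v : HeightOneSpectrum (𝓞 K), ((Nat.card M : ℕ) : 𝓞 K) ∈ v.asIdeal → v ∈ (↑S : Set (HeightOneSpectrum (𝓞 K)))) →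
      ∀ v : Place K, Ext (ofContinuousRep ((ρ.tateDual n).quotientInvariants
        (ramificationSubgroup K (↑S : Set (HeightOneSpectrum (𝓞 K)))))) (IdeleClassBar.truncIdeleBarD K S) 1 →+
          galoisCohomology (ρ.toLocal v) 1)
    (hR3 : ∀ (n : ℕ) [NeZero n] (M : Type) [AddCommGroup M] [TopologicalSpace M] [DiscreteTopology M]
      [Finite M] (ρ : DiscreteGaloisModule K M) (hn : ∀ m : M, n • m = 0)
      (hur : GaloisRep.IsUnramifiedOutside (↑S : Set (HeightOneSpectrum (𝓞 K))) ρ)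
      (hS : ∀ v : HeightOneSpectrum (𝓞 K), ((Nat.card M : ℕ) : 𝓞 K) ∈ v.asIdeal → v ∈ (↑S : Set (HeightOneSpectrum (𝓞 K)))),
      ∀ t : Π v : Place K, galoisCohomology (ρ.toLocal v) 1,
        ∃ e : Ext (ofContinuousRep ((ρ.tateDual n).quotientInvariants
        (ramificationSubgroup K (↑S : Set (HeightOneSpectrum (𝓞 K)))))) (IdeleClassBar.truncIdeleBarD K S) 1,
          ∀ v ∈ (Finset.univ : Finset (InfinitePlace K)).disjSum S, R n M ρ hn hur hS v e = t v)
    (hR4 : ∀ (n : ℕ) [NeZero n] (M : Type) [AddCommGroup M] [TopologicalSpace M] [DiscreteTopology M]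
      [Finite M] (ρ : DiscreteGaloisModule K M) (hn : ∀ m : M, n • m = 0)
      (hur : GaloisRep.IsUnramifiedOutside (↑S : Set (HeightOneSpectrum (𝓞 K))) ρ)
      (hS : ∀ v : HeightOneSpectrum (𝓞 K), ((Nat.card M : ℕ) : 𝓞 K) ∈ v.asIdeal → v ∈ (↑S : Set (HeightOneSpectrum (𝓞 K))))
      (e : Ext (ofContinuousRep ((ρ.tateDual n).quotientInvariants
        (ramificationSubgroup K (↑S : Set (HeightOneSpectrum (𝓞 K)))))) (IdeleClassBar.truncIdeleBarD K S) 1)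
      (y : restrictedCohomology (ρ.tateDual n) (↑S : Set (HeightOneSpectrum (𝓞 K))) 1),
        ShaExtRoad.read ρ (↑S : Set (HeightOneSpectrum (𝓞 K))) (T := IdeleClassBar.truncSeqS K S) (ofContinuousRep ((ρ.tateDual n).quotientInvariants
        (ramificationSubgroup K (↑S : Set (HeightOneSpectrum (𝓞 K)))))) (triv ℤ) (IdeleClassBar.invS S)
            (nat n M ρ) (ShaExtRoad.idelePart (T := IdeleClassBar.truncSeqS K S) (ofContinuousRep ((ρ.tateDual n).quotientInvariants
        (ramificationSubgroup K (↑S : Set (HeightOneSpectrum (𝓞 K)))))) e) y =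
          zmodToQmodZ n (∑ v ∈ (Finset.univ : Finset (InfinitePlace K)).disjSum S,
            localTatePairingZMod ρ n v (LocalInvariants.canonical K n v) (R n M ρ hn hur hS v e)
            (restrictedLocalization (ρ.tateDual n) (↑S : Set (HeightOneSpectrum (𝓞 K))) v 1 y))) :
    poitouTate_shaRestricted_tateDual_natural_at K (↑S : Set (HeightOneSpectrum (𝓞 K))) := by
  classical
  -- the total readout: `R` on admissible triples, `0` elsewhere
  let R' : ∀ (n : ℕ) (M : Type) [AddCommGroup M] [TopologicalSpace M] [DiscreteTopology M] [Finite M]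
      (ρ : DiscreteGaloisModule K M) (v : Place K),
      Ext (ofContinuousRep ((ρ.tateDual n).quotientInvariants
        (ramificationSubgroup K (↑S : Set (HeightOneSpectrum (𝓞 K)))))) (IdeleClassBar.truncIdeleBarD K S) 1 →+
          galoisCohomology (ρ.toLocal v) 1 :=
    fun n M _ _ _ _ ρ v =>
      if h : NeZero n ∧ (∀ m : M, n • m = 0) ∧ GaloisRep.IsUnramifiedOutside (↑S : Set (HeightOneSpectrum (𝓞 K))) ρ ∧
          (∀ v : HeightOneSpectrum (𝓞 K), ((Nat.card M : ℕ) : 𝓞 K) ∈ v.asIdeal → v ∈ (↑S : Set (HeightOneSpectrum (𝓞 K))))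
      then @R n h.1 M _ _ _ _ ρ h.2.1 h.2.2.1 h.2.2.2 v else 0
  have hR' : ∀ (n : ℕ) [NeZero n] (M : Type) [AddCommGroup M] [TopologicalSpace M] [DiscreteTopology M] [Finite M]
      (ρ : DiscreteGaloisModule K M) (hn : ∀ m : M, n • m = 0)
      (hur : GaloisRep.IsUnramifiedOutside (↑S : Set (HeightOneSpectrum (𝓞 K))) ρ)
      (hS : ∀ v : HeightOneSpectrum (𝓞 K), ((Nat.card M : ℕ) : 𝓞 K) ∈ v.asIdeal → v ∈ (↑S : Set (HeightOneSpectrum (𝓞 K))))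
      (v : Place K), R' n M ρ v = R n M ρ hn hur hS v :=
    fun n _ M _ _ _ _ ρ hn hur hS v => dif_pos ⟨‹NeZero n›, hn, hur, hS⟩
  refine natural_at_of_P2mono K S hP2 nat hnat hnatG R' (fun n _ M _ _ _ _ ρ hn hur hS t => ?_)
    (fun n _ M _ _ _ _ ρ hn hur hS e y => ?_)
  · obtain ⟨e, he⟩ := hR3 n M ρ hn hur hS t
    exact ⟨e, fun v hv => by rw [hR' n M ρ hn hur hS v]; exact he v hv⟩
  · rw [hR4 n M ρ hn hur hS e y]
    exact congrArg (zmodToQmodZ n) (Finset.sum_congr rfl fun v _ => by rw [hR' n M ρ hn hur hS v])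

end ShaExtRoadKit

end Literature.NumberTheory.GaloisCohomology

end
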